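import Summits.BirchSwinnertonDyer.BirchSwinnertonDyer.Theorems.BiquadraticEisensteinDescentManinDatumSupercuspidalCMInertPointwiseLever
import Summits.BirchSwinnertonDyer.BirchSwinnertonDyer.Theses.BiquadraticEisensteinDescent
import Literature.NumberTheory.EllipticCurves.ModularityVersionApProofs
import Mathlib.NumberTheory.LegendreSymbol.QuadraticReciprocity
import HarnessLib

set_option linter.dupNamespace false -- `Summit.BirchSwinnertonDyer.BirchSwinnertonDyer.Theorems.…` (summit = sub, D-0017)
set_option autoImplicit false

/-!
# Crux `ManinDatumSupercuspidalCMInert` (stmt-BirchSwinnertonDyer-20111, BED r605): stubs `stub_S5` / `stub_S7` behind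
# the PLAIN ODD prime-modulus twisted values of the curve itself — what the CM side must deliver at `p = 5` and `p = 7`

Route `BiquadraticEisensteinDescent` (cell `pub/bsd-wall`, width seat `bsd-wall-cm-bed-w4` g10; `--supports`
stmt-BirchSwinnertonDyer-20111, helper). Companion of `…ManinDatumSupercuspidalCMInertOfKato` (seat bed-w1 g0, p596084: the same
stubs GRANTED the XL named fact `kato_neron_isIntegral_twistedSymbolSum_of_additive_five_le`, F″) and of the pointwise lever
`…ManinDatumSupercuspidalCMInertPointwiseLever` (this seat). THEOREMS ONLY (no definition, no named fact, no `sorry`); the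
item is NOT closed and BSD is not proved by any of this.

WHAT IS PROVED. The registered stub signatures `stub_S5` / `stub_S7` (skeleton `9438078f…`) VERBATIM, and the route decl
`ManinDatumSupercuspidalCMInert` BY NAME, behind ONE hypothesis each that mentions neither Kato's fact nor any reduction /
irreducibility / local-torsion input — only the CURVE'S OWN odd twisted symbol sums:

* (H₅, hypothesis of `stub_S5_of_plainOddInstances`) for every globally minimal `V` with `j(V) = 0` bad at `5`, its newform `f`
  at conductor level, every prime `ℓ ∤ N_V` with `ℓ ≡ 19 (mod 20)`, every ODD `χ (mod ℓ)` and `ϖ, r` with `ϖ·Ω⁻(V) = Ω⁻_f`,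
  `Σ_a χ(a){∞, a/ℓ}_f = r·Ω⁻_f·i`: `s·ϖ·r ∈ ℤ̄` for some `5 ∤ s`;
* (H₇, hypothesis of `stub_S7_of_plainOddInstances`) the same with `j(V) = 1728`, the prime `7`, and `ℓ ≡ 47, 59, 83 (mod 84)`.

By Birch's formula the quantity is `τ(χ) L(V, χ̄, 1)/(Ω⁻(V) i)`: H₇ is the `p = 7` twin of the PROVED quartic stub
`…InertBadAtThreeQuarticStub.stub_plainOddNeronIntegralThreeQuartic` of crux `InertBadAtThree` (`ℓ ≡ 11 (mod 12)`, `3 ∤ s`;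
quartic twists `y² = x³ − Dx` over `ℤ[i]`, `3` inert) — now `7 ∣ D`, `7` inert in `ℤ[i]`; H₅ is its `ℤ[ω]` sextic twin (`y² = x³ + D`,
`5 ∣ D`, `5` inert in `ℤ[ω]`). The classes of `ℓ`: the lever's auxiliary primes are `ℓ ≡ 3 (mod 4)` with `p ∤ ℓ − 1`, `r ∤ ℓ − 1`
for odd `r ∣ p − 1`, and `p` a square mod `ℓ`; by quadratic reciprocity this is `ℓ ≡ 19 (mod 20)` at `p = 5` and
`ℓ mod 84 ∈ {47, 59, 83}` at `p = 7` (`mod_twenty_of_auxPrime_five`, `mod_eightyFour_of_auxPrime_seven`).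

* `not_dvd_c_of_plainOddInstances57` — the lever in the `(ϖ, r)` currency of the registered stubs (any level `N`, `p ∣ N`);
* `not_five_dvd_c_of_plainOddInstances`, `not_seven_dvd_c_of_plainOddInstances` — conductor level, the two classes of `ℓ`;
* `stub_S5_of_plainOddInstances`, `stub_S7_of_plainOddInstances`, `maninDatumSupercuspidalCMInert_of_plainOddInstances`.

HONEST STATUS: H₅ and H₇ are classical CM computations NOT in the tree (no Literature statement is claimed for them here); this
file only RESHAPES the residual of stmt-BirchSwinnertonDyer-20111 from the XL fact F″ to them. References: [Manin1972] Prop. 1.4 /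
Thm. 1.6; [Mazur1978] §6 Prop. 6.3 (1); [EdixhovenManin1991] §1; [MazurTateTeitelbaum1986] §I.8 (8.6) (Birch's formula);
[IrelandRosen1990] Ch. 18 §4–§7 (the Hecke characters of `y² = x³ − Dx`, `y² = x³ + D`).
-/

noncomputable section

open scoped Classical MatrixGroups

open WeierstrassCurve NumberField Literature.NumberTheory.EllipticCurves
  Literature.NumberTheory.EllipticCurves.ModularForms
  Literature.NumberTheory.EllipticCurves.Rank1Residual
  CongruenceSubgroup Complex

namespace Summit.BirchSwinnertonDyer.BirchSwinnertonDyer.Theorems.BiquadraticEisensteinDescentManinDatumSupercuspidalCMInertOfPlainOddInstances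

open Summit.BirchSwinnertonDyer.BirchSwinnertonDyer.Theses.BiquadraticEisensteinDescent
open Summit.BirchSwinnertonDyer.BirchSwinnertonDyer.Theorems.BiquadraticEisensteinDescentManinDatumSupercuspidalCMInertPointwiseLever
  (not_dvd_c_of_oddPrimeInstances57)

/-! ## §1 The classes of auxiliary primes at `p = 5` and `p = 7` (quadratic reciprocity) -/

/-- `0, 1, 2, 4` are squares mod `7`. [folklore] -/
private theorem isSquare_zmod_seven {k : ℕ} (hk : k = 0 ∨ k = 1 ∨ k = 2 ∨ k = 4) :
    IsSquare ((k : ℕ) : ZMod 7) := by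
  rcases hk with rfl | rfl | rfl | rfl <;> decide

/-- `2, 3` are not squares mod `5`. [folklore] -/
private theorem not_isSquare_zmod_five {k : ℕ} (hk : k = 2 ∨ k = 3) :
    ¬ IsSquare ((k : ℕ) : ZMod 5) := by
  rcases hk with rfl | rfl <;> decide

/-- **The auxiliary primes at `p = 7` are `ℓ ≡ 47, 59, 83 (mod 84)`.** A prime `ℓ > 7` with `4 ∤ ℓ − 1`, `3 ∤ ℓ − 1` and `7` a
square mod `ℓ` satisfies `ℓ ≡ 3 (mod 4)`, `ℓ ≡ 2 (mod 3)` and — by quadratic reciprocity for two primes `≡ 3 (mod 4)` —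
`(ℓ/7) = −(7/ℓ) = −1`, i.e. `ℓ ≡ 3, 5, 6 (mod 7)`. [folklore] -/
theorem mod_eightyFour_of_auxPrime_seven {d : ℕ} (hd : d.Prime) (h4 : ¬ 4 ∣ d - 1) (h3 : ¬ 3 ∣ d - 1)
    (hsq : IsSquare ((7 : ℕ) : ZMod d)) (h7d : 7 < d) :
    d % 84 = 47 ∨ d % 84 = 59 ∨ d % 84 = 83 := by
  haveI : Fact d.Prime := ⟨hd⟩
  haveI : Fact (Nat.Prime 7) := ⟨by norm_num⟩
  have hodd : d % 2 = 1 := hd.mod_two_eq_one_iff_ne_two.mpr (by omega)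
  have h4' : d % 4 = 3 := by omega
  have h70 : ((7 : ℤ) : ZMod d) ≠ 0 := by
    intro h
    have : ((7 : ℕ) : ZMod d) = 0 := by exact_mod_cast h
    rw [ZMod.natCast_eq_zero_iff] at this
    exact absurd (Nat.le_of_dvd (by norm_num) this) (by omega)
  have hleg : legendreSym d 7 = 1 := (legendreSym.eq_one_iff d h70).mpr (by exact_mod_cast hsq)
  have hrec : legendreSym d 7 = -legendreSym 7 d := by
    have := legendreSym.quadratic_reciprocity_three_mod_four (p := 7) (q := d) (by norm_num) h4'
    exact_mod_cast this
  rw [hrec] at hleg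
  have h7d' : legendreSym 7 d = -1 := by linarith
  rw [legendreSym.mod, legendreSym.eq_neg_one_iff] at h7d'
  have hd7 : ((d : ℤ) % ((7 : ℕ) : ℤ)) = ((d % 7 : ℕ) : ℤ) := (Int.natCast_mod d 7).symm
  rw [hd7, Int.cast_natCast] at h7d'
  have h32 : d % 3 = 2 := by
    have hd3 : d % 3 ≠ 0 := by
      intro h0
      have h3d : 3 ∣ d := Nat.dvd_of_mod_eq_zero h0
      have := (Nat.prime_dvd_prime_iff_eq Nat.prime_three hd).mp h3d
      omega
    omega
  have key : d % 7 = 3 ∨ d % 7 = 5 ∨ d % 7 = 6 := by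
    have h7lt : d % 7 < 7 := Nat.mod_lt _ (by norm_num)
    have hns : ¬ (d % 7 = 0 ∨ d % 7 = 1 ∨ d % 7 = 2 ∨ d % 7 = 4) := fun h ↦ h7d' (isSquare_zmod_seven h)
    omega
  clear h7d' hleg hrec h70 hd7 hsq h3 h4 hodd
  omega

/-- **The auxiliary primes at `p = 5` are `ℓ ≡ 19 (mod 20)`.** A prime `ℓ > 5` with `4 ∤ ℓ − 1`, `5 ∤ ℓ − 1` and `5` a square
mod `ℓ` satisfies `ℓ ≡ 3 (mod 4)` and — by quadratic reciprocity (`5 ≡ 1 (mod 4)`) — `(ℓ/5) = (5/ℓ) = 1`, i.e. `ℓ ≡ ±1 (mod 5)`,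
whence `ℓ ≡ 4 (mod 5)`. [folklore] -/
theorem mod_twenty_of_auxPrime_five {d : ℕ} (hd : d.Prime) (h4 : ¬ 4 ∣ d - 1) (h5 : ¬ 5 ∣ d - 1)
    (hsq : IsSquare ((5 : ℕ) : ZMod d)) (h5d : 5 < d) : d % 20 = 19 := by
  haveI : Fact d.Prime := ⟨hd⟩
  haveI : Fact (Nat.Prime 5) := ⟨by norm_num⟩
  have hodd : d % 2 = 1 := hd.mod_two_eq_one_iff_ne_two.mpr (by omega)
  have h4' : d % 4 = 3 := by omega
  have h50 : ((5 : ℤ) : ZMod d) ≠ 0 := by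
    intro h
    have : ((5 : ℕ) : ZMod d) = 0 := by exact_mod_cast h
    rw [ZMod.natCast_eq_zero_iff] at this
    exact absurd (Nat.le_of_dvd (by norm_num) this) (by omega)
  have hleg : legendreSym d 5 = 1 := (legendreSym.eq_one_iff d h50).mpr (by exact_mod_cast hsq)
  have hrec : legendreSym d 5 = legendreSym 5 d := by
    have := legendreSym.quadratic_reciprocity_one_mod_four (p := 5) (q := d) (by norm_num) (by omega)
    exact_mod_cast this
  have hd5 : ((d : ℤ) % ((5 : ℕ) : ℤ)) = ((d % 5 : ℕ) : ℤ) := (Int.natCast_mod d 5).symm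
  rw [hrec, legendreSym.mod, hd5] at hleg
  have h500 : d % 5 ≠ 0 := by
    intro h
    have h5d' : 5 ∣ d := Nat.dvd_of_mod_eq_zero h
    have := (Nat.prime_dvd_prime_iff_eq (by norm_num) hd).mp h5d'
    omega
  have hd50 : (((d % 5 : ℕ) : ℤ) : ZMod 5) ≠ 0 := by
    rw [Int.cast_natCast, Ne, ZMod.natCast_eq_zero_iff]
    intro h
    exact h500 (by omega)
  rw [legendreSym.eq_one_iff 5 hd50, Int.cast_natCast] at hleg
  have key : d % 5 = 4 := by
    have h5lt : d % 5 < 5 := Nat.mod_lt _ (by norm_num)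
    have hns : ¬ (d % 5 = 2 ∨ d % 5 = 3) := fun h ↦ not_isSquare_zmod_five h hleg
    omega
  clear hleg hrec h50 hd5 hsq hd50 h5 h4 hodd h500
  omega

/-! ## §2 The lever in the `(ϖ, r)` currency of the registered stubs -/

section Lever

variable {p : ℕ} [hp : Fact p.Prime]

/-- **`p ∤ c(D)` at a lattice-optimal `X₀(N)`-datum, `p ∈ {5, 7}`, `p ∣ N`, from the PLAIN odd prime-modulus instances for
`D.f` in the `(ϖ, r)` currency**: if for every prime `ℓ > N` with `4 ∤ ℓ − 1`, `p ∤ ℓ − 1`, `r ∤ ℓ − 1` (odd `r ∣ p − 1`), `p` a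
square mod `ℓ`, every ODD `χ (mod ℓ)` and all `ϖ ∈ ℚ`, `r ∈ ℂ` with `ϖ·Ω⁻(W) = Ω⁻_f`, `Σ_a χ(a){∞, a/ℓ}_f = r·Ω⁻_f·i` one has
`s·ϖ·r ∈ ℤ̄` for some `p ∤ s`, then `p ∤ c(D)`. (`ϖ = m/|c|` exists by lattice-optimality, and `ϖ·r` is the symbol sum in Néron
units; then `…PointwiseLever.not_dvd_c_of_oddPrimeInstances57`.) [cite: EdixhovenManin1991, §1] [cite: Manin1972, Thm. 1.6] -/
theorem not_dvd_c_of_plainOddInstances57 (hp57 : p = 5 ∨ p = 7)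
    (W : WeierstrassCurve ℚ) [W.IsElliptic] {N : ℕ} [NeZero N]
    (D : ModularParametrizationData W N)
    (hopt : ∀ z ∈ D.L.lattice, ∃ w ∈ periodLattice D.f, z = D.c * w) (hpN : p ∣ N)
    (hP : ∀ (d' : ℕ) [NeZero d'], d'.Prime → N < d' → ¬ 4 ∣ d' - 1 → ¬ p ∣ d' - 1 →
      (∀ r : ℕ, r.Prime → r ≠ 2 → r ∣ p - 1 → ¬ r ∣ d' - 1) → IsSquare ((p : ZMod d')) →
      ∀ χ : DirichletCharacter ℂ d', χ.Odd →
        ∀ (ϖ : ℚ) (r : ℂ), (ϖ : ℝ) * W.imaginaryPeriodRat = minusPeriod D.f →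
          twistedSymbolSum D.f χ = r * (minusPeriod D.f : ℂ) * Complex.I →
          ∃ s : ℕ, ¬ p ∣ s ∧ IsIntegral ℤ ((s : ℂ) * ϖ * r)) :
    ¬ (p : ℤ) ∣ D.c := by
  have hc0 : D.c ≠ 0 := D.maninConstant_ne_zero_holds
  -- the period scalar `ϖ = m/|c|` of the lattice-optimal datum
  obtain ⟨mm, -, hmm⟩ :=
    SkinnerUrban2014.exists_dvd_two_mul_imaginaryPeriodRat_eq_of_latticeEq D hopt
  set ϖ : ℚ := (mm : ℚ) / |(D.c : ℚ)| with hϖdef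
  have hϖ : (ϖ : ℝ) * W.imaginaryPeriodRat = minusPeriod D.f := by
    have habs0 : |(D.c : ℝ)| ≠ 0 := abs_ne_zero.mpr (by exact_mod_cast hc0)
    rw [hϖdef]; push_cast
    rw [div_mul_eq_mul_div, hmm]
    field_simp
  have hΩf : 0 < minusPeriod D.f :=
    IsNewform0.minusPeriod_pos_holds D.isNewformOf.1 D.isNewformOf.coeffField_eq_bot
  have hΩ : 0 < W.imaginaryPeriodRat := W.imaginaryPeriodRat_pos
  have hΩfC : ((minusPeriod D.f : ℝ) : ℂ) = (ϖ : ℂ) * (W.imaginaryPeriodRat : ℂ) := by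
    rw [← hϖ]; push_cast; ring
  refine not_dvd_c_of_oddPrimeInstances57 hp57 W D hopt hpN ?_
  intro d' _ hd' hNd' hpd' hrd' h4d' hsq χ hχ
  have hsq' : IsSquare ((p : ZMod d')) := by
    rcases hsq with h | h
    · rcases hp57 with rfl | rfl <;> omega
    · exact h
  -- the value `r := Σ/(Ω⁻_f i)` and the instance
  set T : ℂ := twistedSymbolSum D.f χ with hTdef
  set r : ℂ := T / (((minusPeriod D.f : ℝ) : ℂ) * I) with hrdef
  have hden : ((minusPeriod D.f : ℝ) : ℂ) * I ≠ 0 :=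
    mul_ne_zero (by exact_mod_cast hΩf.ne') I_ne_zero
  have hval : T = r * ((minusPeriod D.f : ℝ) : ℂ) * I := by
    rw [hrdef, mul_assoc, div_mul_cancel₀ _ hden]
  obtain ⟨s, hs, hint⟩ := hP d' hd' hNd' h4d' hpd' hrd' hsq' χ hχ ϖ r hϖ hval
  -- `ϖ r = T / (Ω⁻(W) i)`
  have hre : (ϖ : ℂ) * r = T / ((W.imaginaryPeriodRat : ℂ) * I) := by
    rw [hrdef, hΩfC]
    have hΩ0 : (W.imaginaryPeriodRat : ℂ) ≠ 0 := by exact_mod_cast hΩ.ne'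
    have hϖ0 : (ϖ : ℂ) ≠ 0 := by
      have : (ϖ : ℝ) ≠ 0 := by
        rintro h; rw [h, zero_mul] at hϖ; exact hΩf.ne' hϖ.symm
      exact_mod_cast this
    field_simp
  exact ⟨s, hs, by rw [← hre, ← mul_assoc]; exact hint⟩

end Lever

/-! ## §3 Conductor level: the two classes of auxiliary primes -/

/-- **`5 ∤ c(D)` at a lattice-optimal conductor-level datum of a curve bad at `5`, from the plain odd instances at the primes
`ℓ ≡ 19 (mod 20)`, `ℓ ∤ N_W`.** [cite: EdixhovenManin1991, §1] [cite: Manin1972, Thm. 1.6] -/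
theorem not_five_dvd_c_of_plainOddInstances (W : WeierstrassCurve ℚ) [W.IsElliptic] [NeZero (W.conductorNorm ℤ)]
    (D : ModularParametrizationData W (W.conductorNorm ℤ))
    (hopt : ∀ z ∈ D.L.lattice, ∃ w ∈ periodLattice D.f, z = D.c * w) (hbad : ¬ W.HasGoodReductionAtPrime 5)
    (hP : ∀ (ℓ : ℕ) [NeZero ℓ], ℓ.Prime → ¬ ℓ ∣ W.conductorNorm ℤ → ℓ % 20 = 19 →
      ∀ χ : DirichletCharacter ℂ ℓ, χ.Odd →
        ∀ (ϖ : ℚ) (r : ℂ), (ϖ : ℝ) * W.imaginaryPeriodRat = minusPeriod D.f →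
          twistedSymbolSum D.f χ = r * (minusPeriod D.f : ℂ) * Complex.I →
          ∃ s : ℕ, ¬ 5 ∣ s ∧ IsIntegral ℤ ((s : ℂ) * ϖ * r)) :
    ¬ (5 : ℤ) ∣ D.c := by
  haveI : Fact (Nat.Prime 5) := ⟨by norm_num⟩
  have h5N : 5 ∣ W.conductorNorm ℤ := (W.dvd_conductorNorm_iff_not_hasGoodReductionAtPrime 5).mpr hbad
  have hN0 : W.conductorNorm ℤ ≠ 0 := NeZero.ne _
  have h := not_dvd_c_of_plainOddInstances57 (p := 5) (Or.inl rfl) W D hopt h5N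
    (fun d' _ hd' hNd' h4d' hpd' _ hsq χ hχ ϖ r hϖ hval ↦ by
      have h5d : 5 < d' := lt_of_le_of_lt (Nat.le_of_dvd (Nat.pos_of_ne_zero hN0) h5N) hNd'
      have hdN : ¬ d' ∣ W.conductorNorm ℤ := fun hdvd ↦
        absurd (Nat.le_of_dvd (Nat.pos_of_ne_zero hN0) hdvd) (not_le.mpr hNd')
      exact hP d' hd' hdN (mod_twenty_of_auxPrime_five hd' h4d' hpd' hsq h5d) χ hχ ϖ r hϖ hval)
  exact_mod_cast h

/-- **`7 ∤ c(D)` at a lattice-optimal conductor-level datum of a curve bad at `7`, from the plain odd instances at the primes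
`ℓ ≡ 47, 59, 83 (mod 84)`, `ℓ ∤ N_W`.** [cite: EdixhovenManin1991, §1] [cite: Manin1972, Thm. 1.6] -/
theorem not_seven_dvd_c_of_plainOddInstances (W : WeierstrassCurve ℚ) [W.IsElliptic] [NeZero (W.conductorNorm ℤ)]
    (D : ModularParametrizationData W (W.conductorNorm ℤ))
    (hopt : ∀ z ∈ D.L.lattice, ∃ w ∈ periodLattice D.f, z = D.c * w) (hbad : ¬ W.HasGoodReductionAtPrime 7)
    (hP : ∀ (ℓ : ℕ) [NeZero ℓ], ℓ.Prime → ¬ ℓ ∣ W.conductorNorm ℤ → (ℓ % 84 = 47 ∨ ℓ % 84 = 59 ∨ ℓ % 84 = 83) →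
      ∀ χ : DirichletCharacter ℂ ℓ, χ.Odd →
        ∀ (ϖ : ℚ) (r : ℂ), (ϖ : ℝ) * W.imaginaryPeriodRat = minusPeriod D.f →
          twistedSymbolSum D.f χ = r * (minusPeriod D.f : ℂ) * Complex.I →
          ∃ s : ℕ, ¬ 7 ∣ s ∧ IsIntegral ℤ ((s : ℂ) * ϖ * r)) :
    ¬ (7 : ℤ) ∣ D.c := by
  haveI : Fact (Nat.Prime 7) := ⟨by norm_num⟩
  have h7N : 7 ∣ W.conductorNorm ℤ := (W.dvd_conductorNorm_iff_not_hasGoodReductionAtPrime 7).mpr hbad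
  have hN0 : W.conductorNorm ℤ ≠ 0 := NeZero.ne _
  have h := not_dvd_c_of_plainOddInstances57 (p := 7) (Or.inr rfl) W D hopt h7N
    (fun d' _ hd' hNd' h4d' _ hrd' hsq χ hχ ϖ r hϖ hval ↦ by
      have h7d : 7 < d' := lt_of_le_of_lt (Nat.le_of_dvd (Nat.pos_of_ne_zero hN0) h7N) hNd'
      have hdN : ¬ d' ∣ W.conductorNorm ℤ := fun hdvd ↦
        absurd (Nat.le_of_dvd (Nat.pos_of_ne_zero hN0) hdvd) (not_le.mpr hNd')
      have h3 : ¬ 3 ∣ d' - 1 := hrd' 3 Nat.prime_three (by norm_num) (by norm_num)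
      exact hP d' hd' hdN (mod_eightyFour_of_auxPrime_seven hd' h4d' h3 hsq h7d) χ hχ ϖ r hϖ hval)
  exact_mod_cast h

/-! ## §4 The CM cells of BED: the registered stubs behind H₅ / H₇, and the route decl by name -/

/-- **Stub `stub_S5` of skeleton `9438078f…` (crux `ManinDatumSupercuspidalCMInert`, BED r605) — registered signature VERBATIM —
GRANTED H₅**, the plain `5`-integrality in Néron units of the odd twisted symbol sums of the conductor-level newform of every
globally minimal `V` with `j(V) = 0` bad at `5`, prime moduli `ℓ ∤ N_V`, `ℓ ≡ 19 (mod 20)` (a classical `ℤ[ω]` CM computation,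
the sextic twists `y² = x³ + D`, `5 ∣ D`; NOT in the tree). The CM, CM-inert, rank and Kodaira binders of the stub are idle.
[cite: Manin1972, Thm. 1.6] [cite: Mazur1978, §6 Prop. 6.3 (1)] -/
theorem stub_S5_of_plainOddInstances
    (h5 : ∀ (V : WeierstrassCurve ℚ) [V.IsElliptic] [V.IsGloballyMinimal] [NeZero (V.conductorNorm ℤ)],
      V.j = 0 → ¬ V.HasGoodReductionAtPrime 5 →
      ∀ (f : CuspForm (CongruenceSubgroup.Gamma0 (V.conductorNorm ℤ)) 2), IsNewformOf V f →
      ∀ (ℓ : ℕ) [NeZero ℓ], ℓ.Prime → ¬ ℓ ∣ V.conductorNorm ℤ → ℓ % 20 = 19 →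
      ∀ χ : DirichletCharacter ℂ ℓ, χ.Odd →
      ∀ (ϖ : ℚ) (r : ℂ), (ϖ : ℝ) * V.imaginaryPeriodRat = minusPeriod f →
        twistedSymbolSum f χ = r * (minusPeriod f : ℂ) * Complex.I →
        ∃ s : ℕ, ¬ 5 ∣ s ∧ IsIntegral ℤ ((s : ℂ) * ϖ * r)) :
    ∀ (W : WeierstrassCurve ℚ) [W.IsElliptic] [W.IsGloballyMinimal] [NeZero (W.conductorNorm ℤ)] (p : ℕ)
      [Fact p.Prime] (D : ModularParametrizationData W (W.conductorNorm ℤ)) (v : IsDedekindDomain.HeightOneSpectrum ℤ),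
      Rat.HeightOneSpectrum.natGenerator v = p → W.HasCM → W.analyticRank = 1 → p = 5 → W.j = 0 →
      CMInert W p → ¬ Good W p → (∀ z ∈ D.L.lattice, ∃ w ∈ periodLattice D.f, z = D.c * w) →
      (W.kodairaSymbolAt v = .II ∨ W.kodairaSymbolAt v = .IV ∨ W.kodairaSymbolAt v = .IVstar ∨
        W.kodairaSymbolAt v = .IIstar) → ¬ (p : ℤ) ∣ D.c := by
  intro W _ _ _ p _ D v _hv _hCM _hr hp5 hj _hin hbad hopt _hk
  subst hp5
  exact_mod_cast not_five_dvd_c_of_plainOddInstances W D hopt hbad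
    (fun ℓ _ hℓ hℓN h20 χ hχ ϖ r hϖ hval ↦ h5 W hj hbad D.f D.isNewformOf ℓ hℓ hℓN h20 χ hχ ϖ r hϖ hval)

/-- **Stub `stub_S7` of skeleton `9438078f…` (crux `ManinDatumSupercuspidalCMInert`, BED r605) — registered signature VERBATIM —
GRANTED H₇**, the plain `7`-integrality in Néron units of the odd twisted symbol sums of the conductor-level newform of every
globally minimal `V` with `j(V) = 1728` bad at `7`, prime moduli `ℓ ∤ N_V`, `ℓ ≡ 47, 59, 83 (mod 84)` (a classical `ℤ[i]` CM
computation, the quartic twists `y² = x³ − Dx`, `7 ∣ D` — the `p = 7` twin of the proved `p = 3` quartic stub of crux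
`InertBadAtThree`; NOT in the tree). The CM, CM-inert, rank and Kodaira binders of the stub are idle.
[cite: Manin1972, Thm. 1.6] [cite: Mazur1978, §6 Prop. 6.3 (1)] -/
theorem stub_S7_of_plainOddInstances
    (h7 : ∀ (V : WeierstrassCurve ℚ) [V.IsElliptic] [V.IsGloballyMinimal] [NeZero (V.conductorNorm ℤ)],
      V.j = 1728 → ¬ V.HasGoodReductionAtPrime 7 →
      ∀ (f : CuspForm (CongruenceSubgroup.Gamma0 (V.conductorNorm ℤ)) 2), IsNewformOf V f →
      ∀ (ℓ : ℕ) [NeZero ℓ], ℓ.Prime → ¬ ℓ ∣ V.conductorNorm ℤ → (ℓ % 84 = 47 ∨ ℓ % 84 = 59 ∨ ℓ % 84 = 83) →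
      ∀ χ : DirichletCharacter ℂ ℓ, χ.Odd →
      ∀ (ϖ : ℚ) (r : ℂ), (ϖ : ℝ) * V.imaginaryPeriodRat = minusPeriod f →
        twistedSymbolSum f χ = r * (minusPeriod f : ℂ) * Complex.I →
        ∃ s : ℕ, ¬ 7 ∣ s ∧ IsIntegral ℤ ((s : ℂ) * ϖ * r)) :
    ∀ (W : WeierstrassCurve ℚ) [W.IsElliptic] [W.IsGloballyMinimal] [NeZero (W.conductorNorm ℤ)] (p : ℕ)
      [Fact p.Prime] (D : ModularParametrizationData W (W.conductorNorm ℤ)) (v : IsDedekindDomain.HeightOneSpectrum ℤ),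
      Rat.HeightOneSpectrum.natGenerator v = p → W.HasCM → W.analyticRank = 1 → p = 7 → W.j = 1728 →
      CMInert W p → ¬ Good W p → (∀ z ∈ D.L.lattice, ∃ w ∈ periodLattice D.f, z = D.c * w) →
      (W.kodairaSymbolAt v = .III ∨ W.kodairaSymbolAt v = .IIIstar) → ¬ (p : ℤ) ∣ D.c := by
  intro W _ _ _ p _ D v _hv _hCM _hr hp7 hj _hin hbad hopt _hk
  subst hp7
  exact_mod_cast not_seven_dvd_c_of_plainOddInstances W D hopt hbad
    (fun ℓ _ hℓ hℓN h84 χ hχ ϖ r hϖ hval ↦ h7 W hj hbad D.f D.isNewformOf ℓ hℓ hℓN h84 χ hχ ϖ r hϖ hval)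

/-- **The crux `ManinDatumSupercuspidalCMInert` (stmt-BirchSwinnertonDyer-20111) — THE ROUTE DECL BY NAME — GRANTED H₅ and H₇**
(the two plain odd prime-modulus CM statements of `stub_S5_of_plainOddInstances` / `stub_S7_of_plainOddInstances`; composition
of the registered skeleton: the two cells are the two stubs). A CONDITIONAL closer, alternative to
`…ManinDatumSupercuspidalCMInertOfKato.maninDatumSupercuspidalCMInert_of_kato` (Kato's fact F″): no named fact and no
reduction-theoretic input remain on this path, only two classical CM twisted-`L`-value integrality statements. BSD is not proved by
any of this. [cite: Manin1972, Thm. 1.6] [cite: Mazur1978, §6 Prop. 6.3 (1)] [cite: IrelandRosen1990, Ch. 18 §7] -/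
theorem maninDatumSupercuspidalCMInert_of_plainOddInstances
    (h5 : ∀ (V : WeierstrassCurve ℚ) [V.IsElliptic] [V.IsGloballyMinimal] [NeZero (V.conductorNorm ℤ)],
      V.j = 0 → ¬ V.HasGoodReductionAtPrime 5 →
      ∀ (f : CuspForm (CongruenceSubgroup.Gamma0 (V.conductorNorm ℤ)) 2), IsNewformOf V f →
      ∀ (ℓ : ℕ) [NeZero ℓ], ℓ.Prime → ¬ ℓ ∣ V.conductorNorm ℤ → ℓ % 20 = 19 →
      ∀ χ : DirichletCharacter ℂ ℓ, χ.Odd →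
      ∀ (ϖ : ℚ) (r : ℂ), (ϖ : ℝ) * V.imaginaryPeriodRat = minusPeriod f →
        twistedSymbolSum f χ = r * (minusPeriod f : ℂ) * Complex.I →
        ∃ s : ℕ, ¬ 5 ∣ s ∧ IsIntegral ℤ ((s : ℂ) * ϖ * r))
    (h7 : ∀ (V : WeierstrassCurve ℚ) [V.IsElliptic] [V.IsGloballyMinimal] [NeZero (V.conductorNorm ℤ)],
      V.j = 1728 → ¬ V.HasGoodReductionAtPrime 7 →
      ∀ (f : CuspForm (CongruenceSubgroup.Gamma0 (V.conductorNorm ℤ)) 2), IsNewformOf V f →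
      ∀ (ℓ : ℕ) [NeZero ℓ], ℓ.Prime → ¬ ℓ ∣ V.conductorNorm ℤ → (ℓ % 84 = 47 ∨ ℓ % 84 = 59 ∨ ℓ % 84 = 83) →
      ∀ χ : DirichletCharacter ℂ ℓ, χ.Odd →
      ∀ (ϖ : ℚ) (r : ℂ), (ϖ : ℝ) * V.imaginaryPeriodRat = minusPeriod f →
        twistedSymbolSum f χ = r * (minusPeriod f : ℂ) * Complex.I →
        ∃ s : ℕ, ¬ 7 ∣ s ∧ IsIntegral ℤ ((s : ℂ) * ϖ * r)) :
    ManinDatumSupercuspidalCMInert := by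
  intro W _ _ _ p _ D v hv hCM hr _hp57 hin hbad hopt hcell
  rcases hcell with ⟨hp5, hj, hk⟩ | ⟨hp7, hj, hk⟩
  · exact stub_S5_of_plainOddInstances h5 W p D v hv hCM hr hp5 hj hin hbad hopt hk
  · exact stub_S7_of_plainOddInstances h7 W p D v hv hCM hr hp7 hj hin hbad hopt hk

end Summit.BirchSwinnertonDyer.BirchSwinnertonDyer.Theorems.BiquadraticEisensteinDescentManinDatumSupercuspidalCMInertOfPlainOddInstances

end
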